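import Summits.BirchSwinnertonDyer.BirchSwinnertonDyer.Theorems.RamifiedHeegnerPairGss2LowerAtThreeRankOneKolyvaginRoad
import Summits.BirchSwinnertonDyer.BirchSwinnertonDyer.Theses.RamifiedHeegnerPair
import Literature.NumberTheory.EllipticCurves.Kato2004.Condition1252
import HarnessLib

/-!
# Route `RamifiedHeegnerPair`, deciding crux L₁ `Gss2LowerAtThreeRankOne` (stmt-BirchSwinnertonDyer-26021) BY NAME from the
# split-field Kolyvagin road (`…Gss2LowerAtThreeRankOneKolyvaginRoad.lean`), the NON-tower rows displayed

HONEST FRAMING. Theorems only; helper file (`--supports stmt-BirchSwinnertonDyer-26021`); no definition, no named fact, no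
`sorry`; nothing is booked, no item is closed, BSD is not proved for any curve; CONDITIONAL on every displayed input (the
published named facts, the adjusted STEP L resp. the structure theorem + 3-indivisibility on the tower rows, and L₁ ITSELF
on the non-tower rows `hNT`). An honest split of the crux by the 3-adic image, not a closure. Lead prover bsd-line-rhp-p1
g3, 2026-08-28.

* `gss2LowerAtThreeRankOne_of_adjustedIndexBound_of_nonTower` — 26021 ⟸ PUB ∧ [adjusted STEP L at 3 on the tower-row Heegner
  data] ∧ [L₁ on the non-tower rows];
* `gss2LowerAtThreeRankOne_of_structure_of_indivisibility_of_nonTower` — 26021 ⟸ PUB ∧ `AdditiveThree.OneClassLowerBoundShape`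
  ∧ [budgeted 3-indivisibility of the Heegner-point Kolyvagin system on the tower-row data] ∧ [L₁ on the non-tower rows];
* `gss2LowerAtThreeRankOne_of_structure_of_indivisibility_of_nonSurjNine` — the same with the tower bit in its finite
  CERTIFICATE form `surj(9)` (`ρ̄_{E,9}` onto ⟹ `ρ̄_{E,3^n}` onto for all `n`, Serre IV §3.4 Lemma 3;
  `WeierstrassCurve.forall_hasSurjectiveModNGaloisRep_three_pow_of_nine`), so the residual rows are «no `surj(9)`».

References: [cite: JetchevSkinnerWan2017, §7.4.1 (pp. 29–31)] [cite: McCallumLMS1991, Thm. 5.4 (p. 288), Thm. 5.8 (p. 290)]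
[cite: WZhang2014, Thm. 1.1, Thm. 10.2, Remark 18] [cite: SerreAbelianLadic1968, IV §3.4 Lemma 3] [cite: Miller2011LMS, Def. 1.1].
-/

-- D-0017: single-problem summit, so `Summit.BirchSwinnertonDyer.BirchSwinnertonDyer.…` repeats a namespace BY DESIGN.
set_option linter.dupNamespace false
set_option autoImplicit false

noncomputable section

open scoped Classical NumberField

open WeierstrassCurve NumberField IsDedekindDomain
  Literature.NumberTheory.EllipticCurves Literature.NumberTheory.EllipticCurves.ModularForms
  Literature.NumberTheory.EllipticCurves.Rank1Residual
  Literature.NumberTheory.EllipticCurves.Rank1Residual.Typed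
  Summit.BirchSwinnertonDyer.Rank1Residual
  Summit.BirchSwinnertonDyer.Rank1Residual.Additive
  Summit.BirchSwinnertonDyer.Rank1Residual.X11b
  Summit.BirchSwinnertonDyer.Rank1Residual.GaloisImage
  Literature.NumberTheory.Automorphic

namespace Summit.BirchSwinnertonDyer.BirchSwinnertonDyer.Theorems.RamifiedPairLowerBound

/-! ## §4 The crux `Gss2LowerAtThreeRankOne` (stmt-BirchSwinnertonDyer-26021) BY NAME, non-tower rows displayed -/

/-- **L₁ BY NAME from PUB, the ADJUSTED STEP L on the tower rows, and L₁ on the NON-tower rows (displayed).** The route decl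
`Gss2LowerAtThreeRankOne` (¬CM, `Addv`, `SubGss`, `r_an = 1` ⟹ `Typed.MissingLowerBoundAt · 3`) follows from §1 on the rows
with `ρ_{E,3^n}` onto for every `n` and from the hypothesis `hNT` on the others (`ρ̄₃` not onto, or onto with non-full 3-adic
image: no Kato Tamagawa-exact bound and no structure theorem in print there). An honest split, not a closure; the item
stays OPEN. [cite: JetchevSkinnerWan2017, §7.4.1 (pp. 29–31)] [cite: Miller2011LMS, Def. 1.1] -/
theorem gss2LowerAtThreeRankOne_of_adjustedIndexBound_of_nonTower
    (hGZ : ∀ (N : ℕ) [NeZero N] (W : WeierstrassCurve ℚ) (K : Type) [Field K] [NumberField K],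
      gross_zagier N W K)
    (hKo : ∀ (N : ℕ) [NeZero N] (W : WeierstrassCurve ℚ) (K : Type) [Field K] [NumberField K],
      kolyvagin N W K)
    (hKatoT : Kato2004.rankZero_padicValNat_sha_add_padicValNat_tamagawa_le_of_additive_potGood_of_imageContainsSL2)
    (hGZK : rank_eq_analyticRank_of_analyticRank_le_one) (hmod : hasEntireLFunction_rat)
    (hnf : exists_isNewformOf) (hmodP : nonempty_modularParametrizationData)
    (hFH : friedbergHoffstein_exists_heegnerField_split_twist_ne_zero)
    (hL' : ∀ (W : WeierstrassCurve ℚ) [W.IsElliptic] [W.IsGloballyMinimal]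
      (N : ℕ) [NeZero N] (K : Type) [Field K] [NumberField K]
      (Dt : ModularParametrizationData W N) (H : HeegnerDatum N (NumberField.discr K)) (ι : K →+* ℂ)
      (P : (W.baseChange K).toAffine.Point)
      (Wd : WeierstrassCurve ℚ) [Wd.IsElliptic] [Wd.IsGloballyMinimal] (Cd : VariableChange ℚ),
      Addv W 3 → SubGss W 3 → W.analyticRank = 1 → (∀ n : ℕ, W.HasSurjectiveModNGaloisRep (3 ^ n : ℕ)) →
      W.conductorNorm ℤ = N → IsImaginaryQuadratic K → SatisfiesHeegnerHypothesis N K →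
      (W.quadraticTwist (NumberField.discr K : ℚ)).entireLFunction 1 ≠ 0 →
      WeierstrassCurve.Affine.Point.map ι.toRatAlgHom P = heegnerPointComplex Dt H →
      Cd • W.quadraticTwist (NumberField.discr K : ℚ) = Wd →
      Finite (W.baseChange K).sha →
      (2 * padicValNat 3 (AddSubgroup.zmultiples P).index : ℤ) ≤
        padicValNat 3 (W.baseChange K).shaOrder + padicValNat 3 W.tamagawaProduct +
          padicValNat 3 Wd.tamagawaProduct + 2 * padicValRat 3 (Dt.c : ℚ))
    (hNT : ∀ (W : WeierstrassCurve ℚ) [W.IsElliptic] [W.IsGloballyMinimal],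
      ¬ W.HasCM → Addv W 3 → SubGss W 3 → W.analyticRank = 1 →
      ¬ (∀ n : ℕ, W.HasSurjectiveModNGaloisRep (3 ^ n : ℕ)) → MissingLowerBoundAt W 3) :
    Summit.BirchSwinnertonDyer.BirchSwinnertonDyer.Theses.RamifiedHeegnerPair.Gss2LowerAtThreeRankOne := by
  intro W _ _ hCM hadd hsub hr
  by_cases hρ : ∀ n : ℕ, W.HasSurjectiveModNGaloisRep (3 ^ n : ℕ)
  · exact gssLowerAtThree_rankOne_towerRows_of_adjustedIndexBound hGZ hKo hKatoT hGZK hmod hnf hmodP hFH hL' W hadd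
      hsub hr hρ
  · exact hNT W hCM hadd hsub hr hρ

/-- **L₁ BY NAME by the split-field KOLYVAGIN ROAD, non-tower rows displayed**: PUB ∧ `OneClassLowerBoundShape` ∧ the
budgeted 3-indivisibility of the Heegner-point Kolyvagin system on the Gss2 r1 tower-row data (§3's `hInd`) ∧ L₁ on the
non-tower rows ⟹ `Gss2LowerAtThreeRankOne`. The mod-`9` certificate form of the tower bit is
`forall_hasSurjectiveModNGaloisRep_three_pow_of_nine`. CONDITIONAL; closes nothing; BSD is not proved by this.
[cite: McCallumLMS1991, Thm. 5.4 (p. 288), Thm. 5.8 (p. 290)] [cite: WZhang2014, Thm. 1.1, Thm. 10.2, Remark 18]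
[cite: JetchevSkinnerWan2017, §7.4.1 (pp. 29–31)] [cite: Miller2011LMS, Def. 1.1] -/
theorem gss2LowerAtThreeRankOne_of_structure_of_indivisibility_of_nonTower
    (hGZ : ∀ (N : ℕ) [NeZero N] (W : WeierstrassCurve ℚ) (K : Type) [Field K] [NumberField K],
      gross_zagier N W K)
    (hKo : ∀ (N : ℕ) [NeZero N] (W : WeierstrassCurve ℚ) (K : Type) [Field K] [NumberField K],
      kolyvagin N W K)
    (hKatoT : Kato2004.rankZero_padicValNat_sha_add_padicValNat_tamagawa_le_of_additive_potGood_of_imageContainsSL2)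
    (hGZK : rank_eq_analyticRank_of_analyticRank_le_one) (hmod : hasEntireLFunction_rat)
    (hnf : exists_isNewformOf) (hmodP : nonempty_modularParametrizationData)
    (hFH : friedbergHoffstein_exists_heegnerField_split_twist_ne_zero)
    (hSL : AdditiveThree.OneClassLowerBoundShape)
    (hInd : ∀ (W : WeierstrassCurve ℚ) [W.IsElliptic] [W.IsGloballyMinimal] [NeZero (W.conductorNorm ℤ)]
      (K : Type) [Field K] [NumberField K]
      (Dt : ModularParametrizationData W (W.conductorNorm ℤ))
      (H : HeegnerDatum (W.conductorNorm ℤ) (NumberField.discr K)) (ι : K →+* ℂ)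
      (P : (W.baseChange K).toAffine.Point) (Wd : WeierstrassCurve ℚ) [Wd.IsElliptic] [Wd.IsGloballyMinimal],
      Addv W 3 → SubGss W 3 → W.analyticRank = 1 → (∀ n : ℕ, W.HasSurjectiveModNGaloisRep (3 ^ n : ℕ)) →
      IsImaginaryQuadratic K → NumberField.discr K ≠ -3 → NumberField.discr K ≠ -4 →
      SatisfiesHeegnerHypothesis (W.conductorNorm ℤ) K →
      (W.quadraticTwist (NumberField.discr K : ℚ)).entireLFunction 1 ≠ 0 →
      WeierstrassCurve.Affine.Point.map ι.toRatAlgHom P = heegnerPointComplex Dt H → ¬ IsOfFinAddOrder P →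
      (∃ C : VariableChange ℚ, C • W.quadraticTwist (NumberField.discr K : ℚ) = Wd) →
      ∃ m : ℕ, 2 * m ≤ padicValNat 3 W.tamagawaProduct + padicValNat 3 Wd.tamagawaProduct +
        2 * padicValNat 3 Dt.c.natAbs ∧ ¬ AdditiveThree.MinftyGe W K Dt H.β ι (m + 1))
    (hNT : ∀ (W : WeierstrassCurve ℚ) [W.IsElliptic] [W.IsGloballyMinimal],
      ¬ W.HasCM → Addv W 3 → SubGss W 3 → W.analyticRank = 1 →
      ¬ (∀ n : ℕ, W.HasSurjectiveModNGaloisRep (3 ^ n : ℕ)) → MissingLowerBoundAt W 3) :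
    Summit.BirchSwinnertonDyer.BirchSwinnertonDyer.Theses.RamifiedHeegnerPair.Gss2LowerAtThreeRankOne := by
  intro W _ _ hCM hadd hsub hr
  by_cases hρ : ∀ n : ℕ, W.HasSurjectiveModNGaloisRep (3 ^ n : ℕ)
  · exact gssLowerAtThree_rankOne_towerRows_of_structure_of_indivisibility hGZ hKo hKatoT hGZK hmod hnf hmodP hFH hSL
      hInd W hadd hsub hr hρ
  · exact hNT W hCM hadd hsub hr hρ

/-- **L₁ BY NAME by the Kolyvagin road, residual rows = «no `surj(9)`».** As
`gss2LowerAtThreeRankOne_of_structure_of_indivisibility_of_nonTower`, with the tower hypothesis of the road discharged from the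
finite certificate `surj(9)` (`forall_hasSurjectiveModNGaloisRep_three_pow_of_nine`), so that `hN9` displays L₁ only on the rows
WITHOUT a mod-`9` surjectivity certificate. CONDITIONAL; closes nothing. [cite: SerreAbelianLadic1968, IV §3.4 Lemma 3 (IV-23)]
[cite: McCallumLMS1991, Thm. 5.4 (p. 288)] [cite: JetchevSkinnerWan2017, §7.4.1 (pp. 29–31)] [cite: Miller2011LMS, Def. 1.1] -/
theorem gss2LowerAtThreeRankOne_of_structure_of_indivisibility_of_nonSurjNine
    (hGZ : ∀ (N : ℕ) [NeZero N] (W : WeierstrassCurve ℚ) (K : Type) [Field K] [NumberField K],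
      gross_zagier N W K)
    (hKo : ∀ (N : ℕ) [NeZero N] (W : WeierstrassCurve ℚ) (K : Type) [Field K] [NumberField K],
      kolyvagin N W K)
    (hKatoT : Kato2004.rankZero_padicValNat_sha_add_padicValNat_tamagawa_le_of_additive_potGood_of_imageContainsSL2)
    (hGZK : rank_eq_analyticRank_of_analyticRank_le_one) (hmod : hasEntireLFunction_rat)
    (hnf : exists_isNewformOf) (hmodP : nonempty_modularParametrizationData)
    (hFH : friedbergHoffstein_exists_heegnerField_split_twist_ne_zero)
    (hSL : AdditiveThree.OneClassLowerBoundShape)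
    (hInd : ∀ (W : WeierstrassCurve ℚ) [W.IsElliptic] [W.IsGloballyMinimal] [NeZero (W.conductorNorm ℤ)]
      (K : Type) [Field K] [NumberField K]
      (Dt : ModularParametrizationData W (W.conductorNorm ℤ))
      (H : HeegnerDatum (W.conductorNorm ℤ) (NumberField.discr K)) (ι : K →+* ℂ)
      (P : (W.baseChange K).toAffine.Point) (Wd : WeierstrassCurve ℚ) [Wd.IsElliptic] [Wd.IsGloballyMinimal],
      Addv W 3 → SubGss W 3 → W.analyticRank = 1 → (∀ n : ℕ, W.HasSurjectiveModNGaloisRep (3 ^ n : ℕ)) →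
      IsImaginaryQuadratic K → NumberField.discr K ≠ -3 → NumberField.discr K ≠ -4 →
      SatisfiesHeegnerHypothesis (W.conductorNorm ℤ) K →
      (W.quadraticTwist (NumberField.discr K : ℚ)).entireLFunction 1 ≠ 0 →
      WeierstrassCurve.Affine.Point.map ι.toRatAlgHom P = heegnerPointComplex Dt H → ¬ IsOfFinAddOrder P →
      (∃ C : VariableChange ℚ, C • W.quadraticTwist (NumberField.discr K : ℚ) = Wd) →
      ∃ m : ℕ, 2 * m ≤ padicValNat 3 W.tamagawaProduct + padicValNat 3 Wd.tamagawaProduct +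
        2 * padicValNat 3 Dt.c.natAbs ∧ ¬ AdditiveThree.MinftyGe W K Dt H.β ι (m + 1))
    (hN9 : ∀ (W : WeierstrassCurve ℚ) [W.IsElliptic] [W.IsGloballyMinimal],
      ¬ W.HasCM → Addv W 3 → SubGss W 3 → W.analyticRank = 1 →
      ¬ W.HasSurjectiveModNGaloisRep 9 → MissingLowerBoundAt W 3) :
    Summit.BirchSwinnertonDyer.BirchSwinnertonDyer.Theses.RamifiedHeegnerPair.Gss2LowerAtThreeRankOne := by
  refine gss2LowerAtThreeRankOne_of_structure_of_indivisibility_of_nonTower hGZ hKo hKatoT hGZK hmod hnf hmodP hFH hSL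
    hInd ?_
  intro W _ _ hCM hadd hsub hr hρ
  refine hN9 W hCM hadd hsub hr fun h9 ↦ hρ ?_
  exact WeierstrassCurve.forall_hasSurjectiveModNGaloisRep_three_pow_of_nine W h9

end Summit.BirchSwinnertonDyer.BirchSwinnertonDyer.Theorems.RamifiedPairLowerBound

end
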